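import Mathlib.CategoryTheory.Monoidal.Cartesian.Mon
import Mathlib.CategoryTheory.Monoidal.Cartesian.Grp
import Mathlib.RepresentationTheory.Basic
import Mathlib.FieldTheory.AbsoluteGaloisGroup
import Mathlib.GroupTheory.Torsion
import Mathlib.AlgebraicGeometry.Morphisms.Flat
import Literature.AlgebraicGeometry.Motives.Varieties
import Literature.AlgebraicGeometry.Motives.AlgPoints
import Literature.AlgebraicGeometry.Motives.AbelianVariety
import Literature.AlgebraicGeometry.Motives.ZetaFunction
import Literature.NumberTheory.GaloisRepresentations.AbsGaloisGroup
import Literature.NumberTheory.GaloisRepresentations.GaloisCohomology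
import Literature.NumberTheory.GaloisRepresentations.GaloisRep
import Literature.NumberTheory.EllipticCurves.TateModule
import HarnessLib

-- provenance: harness21/H21/H21/Prelude/ArithGeomL/AVGaloisModule.lean @ 158c87f (interim HEAD d8f2665); M5 mechanical rewrite
/-!
# The Galois module `A(K̄)` and the Tate module of an abelian variety (trunk ArithGeomL, C1)

For an abelian variety `A : Literature.AbelianVariety K` over a field `K` (item G17,
`Literature.Prelude.MotiveAbstract.AbelianVariety`) we set up, with real definitions,

* extension of scalars of points `AlgPoints.extendScalars X L L' : X(L) → X(L')` along a tower
  `k → L → L'` (in G17's namespace `Literature.AlgebraicGeometry.Motives.AlgPoints`), a group homomorphism for group schemes;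
* the *geometric points* `A.geomPoints = A(K̄)` written additively (`Additive (A.Points K̄)`),
  with the **discrete** topology and the action of `Γ_K = Field.absoluteGaloisGroup K` by group
  automorphisms (`galAct`, `galActHom`, `geomPoints.instDistribMulAction`), agreeing on the nose
  (`toMul_smul`, by `rfl`) with the action `AlgPoints.instMulActionAbsoluteGaloisGroup` of item
  G23 (`Literature.Prelude.MotiveL.ZetaFunction`); the `ℤ`-linear representation
  `A.galoisRepresentation : Representation ℤ Γ_K A.geomPoints`;
* the inclusion of rational points `A.ratPoints : Additive (A.Points K) →+ A.geomPoints`, Galois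
  descent `A(K̄)^{Γ_K} = A(K)` (perfect `K`, sorried) and the discrete Galois module
  `A.galoisModule h : DiscreteGaloisModule K A.geomPoints` (item G09
  `DiscreteGaloisModule.ofIsOpenStabilizer`, `h` = openness of stabilisers, supplied by the
  sorried theorem `isOpen_stabilizer`);
* the geometric `n`-torsion `A.geomTorsion n = A(K̄)[n]` (Mathlib `AddSubgroup.torsionBy`) and
  its order `n^{2g}` (from G17 `natCard_torsionPoints_of_isAlgClosed`);
* the `ℓ`-adic Tate module `T_ℓ A = A.tateModule ℓ`, the rational Tate module `V_ℓ A`, and the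
  Galois representations `A.tateRep ℓ`, `A.rationalTateRep ℓ`, all instances of the generic API of
  item G16 (`Literature.NumberTheory.EllipticCurves.TateModule`, `Literature.NumberTheory.EllipticCurves.RationalTateModule`, `Literature.NumberTheory.EllipticCurves.tateRepresentation`,
  `Literature.NumberTheory.EllipticCurves.rationalTateRepresentation` in `Literature.Prelude.EllArithM.TateModule`); the structure theorems
  (`T_ℓ A ≅ ℤ_ℓ^{2g}` for `ℓ ≠ char K`, continuity) are sorried theorems, and the glue
  `A.tateGaloisRep ℓ h : GaloisRep K ℤ_[ℓ] (T_ℓ A)` takes the continuity proof `h` as an explicit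
  argument (G16 review-5 rule: no sorried lemma feeds a definition).

## Design notes

* `geomPoints` is a `def` type synonym. It deliberately **replaces** the strong topology that
  `A.Points K̄ = AlgPoints A.X K̄` carries (`AlgPoints.instTopologicalSpace`,
  `Literature.Prelude.MotiveAbstract.AbelianVariety`, docstring of `AbelianVariety.Points`) by the
  discrete topology: this is what `DiscreteGaloisModule` requires and what gives
  `TateModule A.geomPoints ℓ ⊆ ℕ → A(K̄)` its profinite `ℓ`-adic topology.
* The `Γ_K`-action on `geomPoints` is real: `σ • P = specMap σ ≫ P`, packaged through
  `galAct σ : A(K̄) →* A(K̄)` (a homomorphism by Mathlib `MonObj.comp_mul`) and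
  `DistribMulAction.compHom`. The lemma `toMul_smul` records (by `rfl`) that it is G23's action.
* Everything is universe-monomorphic in `K : Type u` (forced by `Spec` and by
  `galoisCohomology`).
* Mathlib has no abelian varieties, no Tate modules and no Galois modules of points (searched
  `TateModule`, `AbelianVariety`, `torsionBy`, `absoluteGaloisGroup`); reused Mathlib pieces:
  `Additive`, `MonoidHom.toAdditive`, `DistribMulAction.compHom`,
  `Representation.ofDistribMulAction`, `AddSubgroup.torsionBy`, `MonObj.comp_mul`,
  `MonObj.comp_one`, `Field.absoluteGaloisGroup`.

## References

* D. Mumford, *Abelian Varieties*, §4 (definition, group law), §6 (torsion, p. 64),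
  §19 (Tate module `T_ℓ`, Thm. 3 and its proof, pp. 171–176).
* J.-P. Serre, J. Tate, *Good reduction of abelian varieties*, Ann. of Math. 88 (1968), §1
  (the `Γ_K`-modules `A(K̄)`, `A[m]`, `T_ℓ(A)`).
* J. H. Silverman, *The Arithmetic of Elliptic Curves*, III.§7, VIII.§1 (the elliptic-curve
  analogue, followed by item G16).
* J.-P. Serre, *Galois Cohomology*, I.§2.1, II.§1 (discrete Galois modules).
-/

universe u

open CategoryTheory AlgebraicGeometry MonoidalCategory Topology

noncomputable section

namespace Literature.NumberTheory.DiophantineGeometry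

/-! ### Extension of scalars of points (namespace `Literature.AlgebraicGeometry.Motives.AlgPoints` of item G17) -/

section AlgPoints
open Literature.AlgebraicGeometry.Motives (AlgPoints)
open Literature.AlgebraicGeometry.Motives.AlgPoints

variable {k : Type u} [Field k] (X : Literature.AlgebraicGeometry.Motives.SchemeOver k)
variable (L L' : Type u) [Field L] [Algebra k L] [Field L'] [Algebra k L'] [Algebra L L']
  [IsScalarTower k L L']

/-- The `k`-morphism `Spec L' ⟶ Spec L` induced by a tower of fields `k → L → L'`
(`Spec` of `algebraMap L L'`; Hartshorne, *Algebraic Geometry*, II.2, Prop. 2.3). Declared in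
G17's namespace `Literature.AlgebraicGeometry.Motives.AlgPoints` on purpose. [folklore] -/
def _root_.Literature.AlgebraicGeometry.Motives.AlgPoints.specOverMap : Literature.AlgebraicGeometry.Motives.specOver k L' ⟶ Literature.AlgebraicGeometry.Motives.specOver k L :=
  Over.homMk (Spec.map (CommRingCat.ofHom (algebraMap L L'))) (by
    change Spec.map _ ≫ Spec.map _ = Spec.map _
    rw [← Spec.map_comp, ← CommRingCat.ofHom_comp, ← IsScalarTower.algebraMap_eq k L L'])

/-- The underlying scheme morphism of `specOverMap L L'` is `Spec (L → L')`
(Hartshorne II.2, Prop. 2.3). [folklore] -/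
@[simp]
theorem _root_.Literature.AlgebraicGeometry.Motives.AlgPoints.specOverMap_left :
    (specOverMap L L' : Literature.AlgebraicGeometry.Motives.specOver k L' ⟶ Literature.AlgebraicGeometry.Motives.specOver k L).left =
      Spec.map (CommRingCat.ofHom (algebraMap L L')) := rfl

/-- For a tower of fields `L → L'`, `Spec L' ⟶ Spec L` is an epimorphism of schemes (it is flat,
every module over a field being flat, and surjective onto the one-point space `Spec L`; Mathlib
`AlgebraicGeometry.Flat.epi_of_flat_of_surjective`; Stacks 01J5, EGA IV 2.2). [folklore] -/
theorem _root_.Literature.AlgebraicGeometry.Motives.AlgPoints.epi_specMap_algebraMap : Epi (Spec.map (CommRingCat.ofHom (algebraMap L L'))) := by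
  have : Flat (Spec.map (CommRingCat.ofHom (algebraMap L L'))) :=
    HasRingHomProperty.Spec_iff.mpr (RingHom.Flat.of_isField (Field.toIsField L) _)
  have : Surjective (Spec.map (CommRingCat.ofHom (algebraMap L L'))) :=
    ⟨fun x ↦ ⟨default, Subsingleton.elim _ _⟩⟩
  exact Flat.epi_of_flat_of_surjective _

/-- Extension of scalars of points along a tower `k → L → L'`: the map `X(L) → X(L')`,
`P ↦ (Spec L' → Spec L) ≫ P` (Hartshorne II Ex. 2.7; Mumford, *Abelian Varieties*, §4 for
`A(K) ⊆ A(K̄)`). [folklore] -/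
def _root_.Literature.AlgebraicGeometry.Motives.AlgPoints.extendScalars (P : AlgPoints X L) : AlgPoints X L' := specOverMap L L' ≫ P

/-- Unfolding `extendScalars`: `extendScalars X L L' P = specOverMap L L' ≫ P`
(Hartshorne II Ex. 2.7). [folklore] -/
theorem _root_.Literature.AlgebraicGeometry.Motives.AlgPoints.extendScalars_apply (P : AlgPoints X L) :
    extendScalars X L L' P = specOverMap L L' ≫ P := rfl

section Group

open scoped MonObj

variable [MonObj X]

/-- For a `k`-group scheme `X`, extension of scalars `X(L) → X(L')` is multiplicative
(pre-composition is a monoid homomorphism: Mathlib `MonObj.comp_mul`; Mumford §4). [folklore] -/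
theorem _root_.Literature.AlgebraicGeometry.Motives.AlgPoints.extendScalars_mul (P Q : AlgPoints X L) :
    extendScalars X L L' (P * Q) = extendScalars X L L' P * extendScalars X L L' Q :=
  MonObj.comp_mul _ _ _

/-- For a `k`-group scheme `X`, extension of scalars sends the identity to the identity
(Mathlib `MonObj.comp_one`; Mumford §4). [folklore] -/
theorem _root_.Literature.AlgebraicGeometry.Motives.AlgPoints.extendScalars_one : extendScalars X L L' (1 : AlgPoints X L) = 1 :=
  MonObj.comp_one _

/-- Extension of scalars `X(L) →* X(L')` as a monoid homomorphism, for a `k`-group scheme `X`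
(Mumford §4; Mathlib `MonObj.comp_mul`, `MonObj.comp_one`). [folklore] -/
def _root_.Literature.AlgebraicGeometry.Motives.AlgPoints.extendScalarsMonoidHom : AlgPoints X L →* AlgPoints X L' where
  toFun := extendScalars X L L'
  map_one' := extendScalars_one X L L'
  map_mul' := extendScalars_mul X L L'

/-- `extendScalarsMonoidHom` is `extendScalars` as a function (Mumford §4). [folklore] -/
@[simp]
theorem _root_.Literature.AlgebraicGeometry.Motives.AlgPoints.extendScalarsMonoidHom_apply (P : AlgPoints X L) :
    extendScalarsMonoidHom X L L' P = extendScalars X L L' P := rfl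

end Group

variable {L L'} in
/-- Compatibility of extension of scalars with the Galois actions: if `σ' ∈ Aut(L'/k)` restricts
to `σ ∈ Aut(L/k)` along `L → L'`, then `σ' • P_{L'} = (σ • P)_{L'}` (Hartshorne II Ex. 4.7;
Silverman, *AEC*, I.2). [folklore] -/
theorem _root_.Literature.AlgebraicGeometry.Motives.AlgPoints.specMap_comp_specOverMap (σ : L ≃ₐ[k] L) (σ' : L' ≃ₐ[k] L')
    (h : ∀ x, σ' (algebraMap L L' x) = algebraMap L L' (σ x)) :
    specMap σ' ≫ specOverMap L L' = (specOverMap L L' ≫ specMap σ : Literature.AlgebraicGeometry.Motives.specOver k L' ⟶ _) := by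
  ext : 1
  change Spec.map _ ≫ Spec.map _ = Spec.map _ ≫ Spec.map _
  rw [← Spec.map_comp, ← Spec.map_comp, ← CommRingCat.ofHom_comp, ← CommRingCat.ofHom_comp]
  congr 2
  exact RingHom.ext fun x => h x

variable {L L'} in
/-- Compatibility of extension of scalars with the Galois actions: if `σ' ∈ Aut(L'/k)` restricts
to `σ ∈ Aut(L/k)` along `L → L'`, then `σ' • P_{L'} = (σ • P)_{L'}` in `X(L')`
(Hartshorne II Ex. 4.7; Silverman, *AEC*, I.2). [folklore] -/
theorem _root_.Literature.AlgebraicGeometry.Motives.AlgPoints.smul_extendScalars (σ : L ≃ₐ[k] L) (σ' : L' ≃ₐ[k] L')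
    (h : ∀ x, σ' (algebraMap L L' x) = algebraMap L L' (σ x)) (P : AlgPoints X L) :
    σ' • extendScalars X L L' P = extendScalars X L L' (σ • P) := by
  rw [smul_def, smul_def, extendScalars_apply, extendScalars_apply, ← Category.assoc,
    specMap_comp_specOverMap σ σ' h, Category.assoc]

/-- Points extended from `L` are fixed by `Aut(L'/L)`: for `σ' : L' ≃ₐ[L] L'`,
`σ' • P_{L'} = P_{L'}` (Hartshorne II Ex. 4.7; Silverman, *AEC*, I.2). [folklore] -/
theorem _root_.Literature.AlgebraicGeometry.Motives.AlgPoints.restrictScalars_smul_extendScalars (σ' : L' ≃ₐ[L] L') (P : AlgPoints X L) :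
    AlgEquiv.restrictScalars k σ' • extendScalars X L L' P = extendScalars X L L' P := by
  have h := smul_extendScalars X (1 : L ≃ₐ[k] L) (AlgEquiv.restrictScalars k σ')
    (fun x => σ'.commutes x) P
  rwa [one_smul] at h

/-- Extension of scalars of points along a field extension is injective: an `L`-point is a point
`x ∈ X` with an embedding `κ(x) → L`, and `L → L'` is injective; equivalently `Spec L' ⟶ Spec L`
is an epimorphism (`epi_specMap_algebraMap`) and morphisms of `Over (Spec k)` are determined by
their underlying scheme morphisms (Hartshorne II Ex. 2.7; Stacks 01J5). [cite: Hartshorne1977, II Ex. 2.7] -/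
theorem _root_.Literature.AlgebraicGeometry.Motives.AlgPoints.extendScalars_injective : Function.Injective (extendScalars X L L') := by
  intro P Q h
  have h' := congrArg CommaMorphism.left h
  simp only [extendScalars, Over.comp_left, specOverMap, Over.homMk_left] at h'
  haveI := epi_specMap_algebraMap L L'
  exact Over.OverMorphism.ext
    ((cancel_epi (Spec.map (CommRingCat.ofHom (algebraMap L L')))).mp h')

end AlgPoints

/-! ### Geometric points of an abelian variety as a `Γ_K`-module -/

section AbelianVariety
open Literature.AlgebraicGeometry.Motives (AbelianVariety)
open Literature.AlgebraicGeometry.Motives.AbelianVariety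

open scoped MonObj

variable {K : Type u} [Field K] (A : AbelianVariety K)

/-- The *geometric points* `A(K̄)` of an abelian variety `A / K`, written additively: the type
synonym `Additive (A.Points K̄)` with `K̄ = AlgebraicClosure K` (Mumford, *Abelian Varieties*,
§4; Serre–Tate 1968, §1). This synonym deliberately **replaces** the strong topology of
`A.Points K̄ = AlgPoints A.X K̄` (`AlgPoints.instTopologicalSpace`, see the docstring of
`AbelianVariety.Points`) by the *discrete* topology (`geomPoints.instTopologicalSpace`), as needed
by `Literature.NumberTheory.GaloisRepresentations.DiscreteGaloisModule` and so that `Literature.TateModule A.geomPoints ℓ` gets its `ℓ`-adic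
(profinite) topology. [cite: SerreTate1968, §1] -/
def _root_.Literature.AlgebraicGeometry.Motives.AbelianVariety.geomPoints : Type u := Additive (A.Points (AlgebraicClosure K))

/-- `A(K̄)` is an abelian group (Mumford §4; Mathlib's scoped `Hom.commGroup`, made additive). [folklore] -/
instance _root_.Literature.AlgebraicGeometry.Motives.AbelianVariety.geomPoints.instAddCommGroup : AddCommGroup A.geomPoints :=
  inferInstanceAs (AddCommGroup (Additive (A.Points (AlgebraicClosure K))))

/-- `A(K̄)` carries the discrete topology (it is a discrete `Γ_K`-module; Serre,
*Galois Cohomology*, II.§1; Serre–Tate 1968, §1). [cite: SerreTate1968, §1] -/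
instance _root_.Literature.AlgebraicGeometry.Motives.AbelianVariety.geomPoints.instTopologicalSpace : TopologicalSpace A.geomPoints := ⊥

/-- The topology on `A(K̄)` is discrete by definition (Serre, *Galois Cohomology*, II.§1). [folklore] -/
instance _root_.Literature.AlgebraicGeometry.Motives.AbelianVariety.geomPoints.instDiscreteTopology : DiscreteTopology A.geomPoints := ⟨rfl⟩

/-- The action of `σ ∈ Aut(K̄/K)` on `A(K̄)`, `P ↦ σ • P = specMap σ ≫ P`, is a group
homomorphism, because the group law of `A` is defined over `K` (Mumford §4; real proof by Mathlib
`MonObj.comp_one`, `MonObj.comp_mul`). [folklore] -/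
def _root_.Literature.AlgebraicGeometry.Motives.AbelianVariety.galAct (σ : AlgebraicClosure K ≃ₐ[K] AlgebraicClosure K) :
    A.Points (AlgebraicClosure K) →* A.Points (AlgebraicClosure K) where
  toFun P := σ • P
  map_one' := by rw [Literature.AlgebraicGeometry.Motives.AlgPoints.smul_def]; exact MonObj.comp_one _
  map_mul' P Q := by rw [Literature.AlgebraicGeometry.Motives.AlgPoints.smul_def]; exact MonObj.comp_mul _ _ _

/-- `galAct σ P = σ • P` (Mumford §4; Hartshorne II Ex. 4.7). [folklore] -/
@[simp]
theorem _root_.Literature.AlgebraicGeometry.Motives.AbelianVariety.galAct_apply (σ : AlgebraicClosure K ≃ₐ[K] AlgebraicClosure K)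
    (P : A.Points (AlgebraicClosure K)) : A.galAct σ P = σ • P := rfl

/-- The identity of `Aut(K̄/K)` acts trivially (Mumford §4). [folklore] -/
@[simp]
theorem _root_.Literature.AlgebraicGeometry.Motives.AbelianVariety.galAct_one : A.galAct 1 = MonoidHom.id _ := by
  ext P
  simp

/-- `galAct` is multiplicative: `galAct (σ τ) = galAct σ ∘ galAct τ` (it is a left action;
Mumford §4). [folklore] -/
theorem _root_.Literature.AlgebraicGeometry.Motives.AbelianVariety.galAct_mul (σ τ : AlgebraicClosure K ≃ₐ[K] AlgebraicClosure K) :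
    A.galAct (σ * τ) = (A.galAct σ).comp (A.galAct τ) := by
  ext P
  simp [mul_smul]

/-- The action of `Γ_K = Gal(K̄/K)` on `A(K̄)` by group automorphisms, as a homomorphism
`Γ_K →* End(A(K̄))` (Mumford §4; Serre–Tate 1968, §1). Built from `galAct` via
`Field.absoluteGaloisGroup.toAlgEquiv` and Mathlib `MonoidHom.toAdditive`. [cite: SerreTate1968, §1] -/
def _root_.Literature.AlgebraicGeometry.Motives.AbelianVariety.galActHom : Field.absoluteGaloisGroup K →* AddMonoid.End A.geomPoints where
  toFun σ := MonoidHom.toAdditive (A.galAct (Field.absoluteGaloisGroup.toAlgEquiv K σ))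
  map_one' := by rw [map_one, galAct_one]; rfl
  map_mul' σ τ := by rw [map_mul, galAct_mul]; rfl

/-- `Γ_K` acts on `A(K̄)` by group automorphisms (Mumford §4; Serre–Tate 1968, §1): Mathlib
`DistribMulAction.compHom` along `galActHom`. No Mathlib instance exists on this synonym. [cite: SerreTate1968, §1] -/
instance _root_.Literature.AlgebraicGeometry.Motives.AbelianVariety.geomPoints.instDistribMulAction :
    DistribMulAction (Field.absoluteGaloisGroup K) A.geomPoints :=
  DistribMulAction.compHom _ A.galActHom

variable {A}

/-- Definition of the `Γ_K`-action on `A(K̄)`: `σ • P = galActHom σ P` (Mumford §4). [folklore] -/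
theorem _root_.Literature.AlgebraicGeometry.Motives.AbelianVariety.smul_def (σ : Field.absoluteGaloisGroup K) (P : A.geomPoints) :
    σ • P = A.galActHom σ P := rfl

/-- The `Γ_K`-action on `A.geomPoints` **is** the action of item G23
(`AlgPoints.instMulActionAbsoluteGaloisGroup`, `σ • P = specMap σ ≫ P`) transported along
`Additive`: `toMul (σ • P) = σ • toMul P`, by `rfl` (Hartshorne II Ex. 4.7). [folklore] -/
@[simp]
theorem _root_.Literature.AlgebraicGeometry.Motives.AbelianVariety.toMul_smul (σ : Field.absoluteGaloisGroup K) (P : A.geomPoints) :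
    Additive.toMul (σ • P) = σ • (Additive.toMul P : A.Points (AlgebraicClosure K)) := rfl

/-- Companion of `toMul_smul`: `ofMul (σ • P) = σ • ofMul P` for `P ∈ A(K̄)`, the left-hand
`•` being the G23 action on `A.Points K̄` and the right-hand one the action on `A.geomPoints`
(the `HSMul` type annotations force the synonym); by `rfl` (Hartshorne II Ex. 4.7). [folklore] -/
theorem _root_.Literature.AlgebraicGeometry.Motives.AbelianVariety.ofMul_smul (σ : Field.absoluteGaloisGroup K) (P : A.Points (AlgebraicClosure K)) :
    Additive.ofMul (σ • P) =
      HSMul.hSMul (β := A.geomPoints) (γ := A.geomPoints) σ (Additive.ofMul P) := rfl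

variable (A)

/-- The `ℤ`-linear representation of `Γ_K` on `A(K̄)` (Mathlib
`Representation.ofDistribMulAction`; Serre–Tate 1968, §1). [cite: SerreTate1968, §1] -/
def _root_.Literature.AlgebraicGeometry.Motives.AbelianVariety.galoisRepresentation : Representation ℤ (Field.absoluteGaloisGroup K) A.geomPoints :=
  Representation.ofDistribMulAction ℤ (Field.absoluteGaloisGroup K) A.geomPoints

variable {A} in
/-- Unfolding `galoisRepresentation`: `ρ(σ) P = σ • P`. [folklore] -/
@[simp]
theorem _root_.Literature.AlgebraicGeometry.Motives.AbelianVariety.galoisRepresentation_apply_apply (σ : Field.absoluteGaloisGroup K) (P : A.geomPoints) :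
    A.galoisRepresentation σ P = σ • P := rfl

/-! ### Rational points and Galois descent -/

/-- The inclusion `A(K) ↪ A(K̄)` of the `K`-rational points into the geometric points, as an
additive homomorphism (`AlgPoints.extendScalarsMonoidHom` along `K → K̄`, made additive;
Mumford §4; Silverman, *AEC*, VIII.§1 for elliptic curves). [folklore] -/
def _root_.Literature.AlgebraicGeometry.Motives.AbelianVariety.ratPoints : Additive (A.Points K) →+ A.geomPoints :=
  MonoidHom.toAdditive (Literature.AlgebraicGeometry.Motives.AlgPoints.extendScalarsMonoidHom A.X K (AlgebraicClosure K))

variable {A}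

/-- Unfolding `ratPoints`: `toMul (ratPoints P) = extendScalars (toMul P)` (Mumford §4). [folklore] -/
theorem _root_.Literature.AlgebraicGeometry.Motives.AbelianVariety.toMul_ratPoints (P : Additive (A.Points K)) :
    Additive.toMul (A.ratPoints P) =
      Literature.AlgebraicGeometry.Motives.AlgPoints.extendScalars A.X K (AlgebraicClosure K) (Additive.toMul P) := rfl

/-- `A(K) → A(K̄)` is injective (Mumford §4; `AlgPoints.extendScalars_injective`). [folklore] -/
theorem _root_.Literature.AlgebraicGeometry.Motives.AbelianVariety.ratPoints_injective : Function.Injective A.ratPoints := fun _ _ h =>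
  Additive.toMul.injective (Literature.AlgebraicGeometry.Motives.AlgPoints.extendScalars_injective A.X K (AlgebraicClosure K)
    (congrArg Additive.toMul h))

/-- Rational points are fixed by `Γ_K` (real proof: `K → K̄` is `Γ_K`-invariant;
Silverman, *AEC*, VIII.§1). [folklore] -/
@[simp]
theorem _root_.Literature.AlgebraicGeometry.Motives.AbelianVariety.smul_ratPoints (σ : Field.absoluteGaloisGroup K) (P : Additive (A.Points K)) :
    σ • A.ratPoints P = A.ratPoints P := by
  apply Additive.toMul.injective
  rw [AbelianVariety.toMul_smul, toMul_ratPoints, Literature.AlgebraicGeometry.Motives.AlgPoints.absoluteGaloisGroup_smul_def, ← Literature.AlgebraicGeometry.Motives.AlgPoints.smul_def]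
  exact Literature.AlgebraicGeometry.Motives.AlgPoints.restrictScalars_smul_extendScalars A.X K (AlgebraicClosure K)
    (Field.absoluteGaloisGroup.toAlgEquiv K σ) _

variable (A) in
/-- **Galois descent for points** over a perfect field: `A(K̄)^{Γ_K} = A(K)`, i.e. the range of
`ratPoints` is the set of `Γ_K`-fixed geometric points (over an imperfect field the fixed points
are the points over the perfect closure, whence `[PerfectField K]`). Mumford §4; Serre,
*Galois Cohomology*, II.§1; Silverman, *AEC*, VIII.§1 (elliptic curves). [cite: SerreGaloisCohomology1997, II.§1] -/
def _root_.Literature.AlgebraicGeometry.Motives.AbelianVariety.range_ratPoints_eq_setOf_forall_smul_eq : Prop :=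
  ∀ [PerfectField K],
    Set.range A.ratPoints = {P : A.geomPoints | ∀ σ : Field.absoluteGaloisGroup K, σ • P = P}

/-- The stabiliser in `Γ_K` of a geometric point is open for the Krull topology (it contains
`Gal(K̄/K(P))` with `K(P)/K` finite, `A` being of finite type over `K`), i.e. `A(K̄)` is a
discrete `Γ_K`-module (Serre, *Galois Cohomology*, II.§1; Serre–Tate 1968, §1). [cite: SerreTate1968, §1] -/
def _root_.Literature.AlgebraicGeometry.Motives.AbelianVariety.isOpen_stabilizer : Prop :=
  ∀ (P : A.geomPoints),
    IsOpen {σ : Field.absoluteGaloisGroup K | σ • P = P}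

variable (A) in
/-- `A(K̄)` as a discrete Galois module `DiscreteGaloisModule K A.geomPoints` (item G09
`DiscreteGaloisModule.ofIsOpenStabilizer` applied to `galoisRepresentation`), given a proof `h`
that all stabilisers are open — supplied by the (sorried) theorem `isOpen_stabilizer`, hence an
explicit argument. Its Galois cohomology `H¹(K, A)` is `galoisCohomology (A.galoisModule h) 1`.
Serre, *Galois Cohomology*, II.§1; Serre–Tate 1968, §1. [cite: SerreTate1968, §1] -/
def _root_.Literature.AlgebraicGeometry.Motives.AbelianVariety.galoisModule (h : ∀ P : A.geomPoints, IsOpen {σ : Field.absoluteGaloisGroup K | σ • P = P}) :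
    GaloisRepresentations.DiscreteGaloisModule K A.geomPoints :=
  GaloisRepresentations.DiscreteGaloisModule.ofIsOpenStabilizer A.galoisRepresentation h

/-- The underlying representation of `galoisModule` is `galoisRepresentation`. [folklore] -/
@[simp]
theorem _root_.Literature.AlgebraicGeometry.Motives.AbelianVariety.galoisModule_toRepresentation
    (h : ∀ P : A.geomPoints, IsOpen {σ : Field.absoluteGaloisGroup K | σ • P = P}) :
    (A.galoisModule h).toRepresentation = A.galoisRepresentation := rfl

/-! ### Geometric torsion points -/


variable (A) in
/-- The geometric `n`-torsion `A[n] = A(K̄)[n] = {P | n • P = 0}` as a subgroup of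
`A.geomPoints`, for `n : ℤ` (Mathlib `AddSubgroup.torsionBy`; Mumford §6, p. 64; Serre–Tate 1968,
§1). An `abbrev` (as G16 `WeierstrassCurve.geomTorsion`), so that the induced `Γ_K`-action
`Literature.NumberTheory.EllipticCurves.AddSubgroup.torsionBy.instDistribMulAction` and Mathlib's `AddSubgroup.torsionBy.zmodModule`
apply to it verbatim. [cite: SerreTate1968, §1] -/
abbrev _root_.Literature.AlgebraicGeometry.Motives.AbelianVariety.geomTorsion (n : ℤ) : AddSubgroup A.geomPoints := AddSubgroup.torsionBy A.geomPoints n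

/-- Membership in the geometric `n`-torsion: `P ∈ A[n] ↔ n • P = 0` (Mumford §6). [folklore] -/
theorem _root_.Literature.AlgebraicGeometry.Motives.AbelianVariety.mem_geomTorsion_iff' {n : ℤ} (P : A.geomPoints) : P ∈ A.geomTorsion n ↔ n • P = 0 :=
  Submodule.mem_torsionBy_iff n P

/-- The geometric `n`-torsion is G17's `A.torsionPoints K̄ n` transported along `Additive`:
`P ∈ A[n] ↔ toMul P ∈ A[n](K̄)` (Mumford §6). [folklore] -/
theorem _root_.Literature.AlgebraicGeometry.Motives.AbelianVariety.mem_geomTorsion_iff {n : ℤ} (P : A.geomPoints) :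
    P ∈ A.geomTorsion n ↔ Additive.toMul P ∈ A.torsionPoints (AlgebraicClosure K) n :=
  Iff.rfl

/-- `A[n]` is `Γ_K`-stable (the group law is defined over `K`; Mumford §6; Serre–Tate 1968, §1).
Real proof from the `DistribMulAction` (`Literature.NumberTheory.EllipticCurves.smul_mem_torsionBy`). [cite: SerreTate1968, §1] -/
theorem _root_.Literature.AlgebraicGeometry.Motives.AbelianVariety.smul_mem_geomTorsion {n : ℤ} (σ : Field.absoluteGaloisGroup K) {P : A.geomPoints}
    (hP : P ∈ A.geomTorsion n) : σ • P ∈ A.geomTorsion n :=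
  Literature.NumberTheory.EllipticCurves.smul_mem_torsionBy σ hP

variable (A) in
/-- `A[n] ≃ A[n](K̄)`: the geometric torsion of this file and of item G17 have the same elements
(transport along `Additive.toMul`; Mumford §6). [folklore] -/
def _root_.Literature.AlgebraicGeometry.Motives.AbelianVariety.geomTorsionEquiv (n : ℤ) : A.geomTorsion n ≃ A.torsionPoints (AlgebraicClosure K) n :=
  Additive.toMul.subtypeEquiv mem_geomTorsion_iff

variable (A) in
/-- For `n` invertible in `K`, the geometric `n`-torsion of a `g`-dimensional abelian variety has
`n^{2g}` elements, `A[n] ≃ (ℤ/nℤ)^{2g}` (Mumford §6, Proposition p. 64 and Appendix to §7),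
given the named fact `h : A.natCard_torsionPoints_of_isAlgClosed K̄` of item G17 (D-0014: an
explicit hypothesis) transported along `geomTorsionEquiv`. [cite: MumfordAV1970, §6 Application 3 (Proposition p. 64) and Appendix to §7] -/
theorem _root_.Literature.AlgebraicGeometry.Motives.AbelianVariety.natCard_geomTorsion (h : A.natCard_torsionPoints_of_isAlgClosed (AlgebraicClosure K))
    (n : ℤ) (hn : (n : K) ≠ 0) :
    Nat.card (A.geomTorsion n) = n.natAbs ^ (2 * A.dim) := by
  rw [Nat.card_congr (A.geomTorsionEquiv n)]
  exact h n hn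

/-! ### The Tate module -/

variable (A) (ℓ : ℕ)

/-- The `ℓ`-adic **Tate module** `T_ℓ A = lim← A[ℓⁿ]` of `A`, with its profinite topology
(subspace of `ℕ → A(K̄)`, `A(K̄)` discrete) and componentwise `Γ_K`-action: item G16
`Literature.TateModule A.geomPoints ℓ` (Mumford §19, p. 171; Serre–Tate 1968, §1; Silverman, *AEC*,
III.§7 for elliptic curves). [cite: SerreTate1968, §1] -/
abbrev _root_.Literature.AlgebraicGeometry.Motives.AbelianVariety.tateModule : Type u := EllipticCurves.TateModule A.geomPoints ℓ

variable [Fact ℓ.Prime]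

/-- The rational Tate module `V_ℓ A = ℚ_ℓ ⊗_{ℤ_ℓ} T_ℓ A` with its module topology over `ℚ_[ℓ]`:
item G16 `Literature.RationalTateModule A.geomPoints ℓ` (Mumford §19, p. 172; Serre–Tate 1968, §1). [cite: SerreTate1968, §1] -/
abbrev _root_.Literature.AlgebraicGeometry.Motives.AbelianVariety.rationalTateModule : Type u := EllipticCurves.RationalTateModule A.geomPoints ℓ

/-- The `ℓ`-adic Galois representation `ρ_{A,ℓ} : Γ_K → Aut_{ℤ_ℓ}(T_ℓ A)`: item G16
`Literature.tateRepresentation Γ_K A.geomPoints ℓ` (Mumford §19, pp. 171–176; Serre–Tate 1968, §1;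
Silverman, *AEC*, III.§7). [cite: SerreTate1968, §1] -/
def _root_.Literature.AlgebraicGeometry.Motives.AbelianVariety.tateRep : Representation ℤ_[ℓ] (Field.absoluteGaloisGroup K) (A.tateModule ℓ) :=
  EllipticCurves.tateRepresentation (Field.absoluteGaloisGroup K) A.geomPoints ℓ

variable {A ℓ} in
/-- Unfolding `tateRep`: `ρ_{A,ℓ}(σ) a = σ • a` (componentwise action). [folklore] -/
@[simp]
theorem _root_.Literature.AlgebraicGeometry.Motives.AbelianVariety.tateRep_apply_apply (σ : Field.absoluteGaloisGroup K) (a : A.tateModule ℓ) :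
    A.tateRep ℓ σ a = σ • a := rfl

/-- The rational `ℓ`-adic Galois representation `Γ_K → Aut_{ℚ_ℓ}(V_ℓ A)`: item G16
`Literature.rationalTateRepresentation Γ_K A.geomPoints ℓ` (Mumford §19; Serre–Tate 1968, §1). [cite: SerreTate1968, §1] -/
def _root_.Literature.AlgebraicGeometry.Motives.AbelianVariety.rationalTateRep :
    Representation ℚ_[ℓ] (Field.absoluteGaloisGroup K) (A.rationalTateModule ℓ) :=
  EllipticCurves.rationalTateRepresentation (Field.absoluteGaloisGroup K) A.geomPoints ℓ

/-- For `ℓ ≠ char K`, `T_ℓ A` is a free `ℤ_ℓ`-module (of rank `2g`; Mumford §19, p. 171,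
via §6 Proposition p. 64). Consumed downstream only as an explicit hypothesis. [cite: MumfordAV1970, §19 p. 171] -/
def _root_.Literature.AlgebraicGeometry.Motives.AbelianVariety.module_free_tateModule : Prop :=
  ∀ (hℓ : (ℓ : K) ≠ 0),
    Module.Free ℤ_[ℓ] (A.tateModule ℓ)

/-- `T_ℓ A` is a finitely generated `ℤ_ℓ`-module (Mumford §19, p. 171; for `ℓ = char K` it is
free of rank `≤ g`, Mumford §15, p. 147). Consumed downstream only as an explicit hypothesis. [cite: MumfordAV1970, §19 p. 171 and §15 p. 147] -/
def _root_.Literature.AlgebraicGeometry.Motives.AbelianVariety.module_finite_tateModule : Prop :=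
  Module.Finite ℤ_[ℓ] (A.tateModule ℓ)

/-- For `ℓ ≠ char K` and `A` of dimension `g`, `T_ℓ A ≅ ℤ_ℓ^{2g}`:
`rank_{ℤ_ℓ} T_ℓ A = 2g` (Mumford §19, p. 171; Serre–Tate 1968, §1). [cite: SerreTate1968, §1] -/
def _root_.Literature.AlgebraicGeometry.Motives.AbelianVariety.finrank_tateModule_eq : Prop :=
  ∀ (hℓ : (ℓ : K) ≠ 0),
    Module.finrank ℤ_[ℓ] (A.tateModule ℓ) = 2 * A.dim

/-- For `ℓ ≠ char K` and `A` of dimension `g`, `dim_{ℚ_ℓ} V_ℓ A = 2g` (Mumford §19, p. 172). [cite: MumfordAV1970, §19 p. 172] -/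
def _root_.Literature.AlgebraicGeometry.Motives.AbelianVariety.finrank_rationalTateModule_eq : Prop :=
  ∀ (hℓ : (ℓ : K) ≠ 0),
    Module.finrank ℚ_[ℓ] (A.rationalTateModule ℓ) = 2 * A.dim

/-- The Galois action `Γ_K × T_ℓ A → T_ℓ A` is jointly continuous for the Krull topology on `Γ_K`
and the profinite topology on `T_ℓ A` (each `A[ℓⁿ]` is a finite discrete `Γ_K`-module;
Serre–Tate 1968, §1; Serre, *Abelian ℓ-adic representations*, I.1.2). [cite: SerreTate1968, §1] -/
def _root_.Literature.AlgebraicGeometry.Motives.AbelianVariety.continuous_tateRep : Prop :=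
  Continuous fun p : Field.absoluteGaloisGroup K × A.tateModule ℓ ↦ A.tateRep ℓ p.1 p.2

/-- The Galois action `Γ_K × V_ℓ A → V_ℓ A` is jointly continuous for the module topology on the
finite-dimensional `ℚ_ℓ`-vector space `V_ℓ A` (`ℓ ≠ char K`; Serre–Tate 1968, §1; Serre,
*Abelian ℓ-adic representations*, I.1.2). [cite: SerreTate1968, §1] -/
def _root_.Literature.AlgebraicGeometry.Motives.AbelianVariety.continuous_rationalTateRep : Prop :=
  ∀ (hℓ : (ℓ : K) ≠ 0),
    Continuous fun p : Field.absoluteGaloisGroup K × A.rationalTateModule ℓ ↦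
      A.rationalTateRep ℓ p.1 p.2

/-! ### Glue to `Literature.NumberTheory.GaloisRepresentations.GaloisRep` -/

/-- The `ℓ`-adic Tate module as a continuous Galois representation
`GaloisRep K ℤ_[ℓ] (T_ℓ A)` (item G09 `Literature.NumberTheory.GaloisRepresentations.GaloisRep`), given a proof `h` of joint continuity —
supplied by the sorried theorem `continuous_tateRep A ℓ`, hence an explicit argument (same shape
as G16 `WeierstrassCurve.tateGaloisRep`). Serre–Tate 1968, §1. [cite: SerreTate1968, §1] -/
def _root_.Literature.AlgebraicGeometry.Motives.AbelianVariety.tateGaloisRep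
    (h : Continuous fun p : Field.absoluteGaloisGroup K × A.tateModule ℓ ↦ A.tateRep ℓ p.1 p.2) :
    GaloisRepresentations.GaloisRep K ℤ_[ℓ] (A.tateModule ℓ) :=
  ⟨A.tateRep ℓ, h⟩

variable {A ℓ} in
/-- The underlying representation of `tateGaloisRep` is `tateRep`. [folklore] -/
@[simp]
theorem _root_.Literature.AlgebraicGeometry.Motives.AbelianVariety.tateGaloisRep_toRepresentation
    (h : Continuous fun p : Field.absoluteGaloisGroup K × A.tateModule ℓ ↦ A.tateRep ℓ p.1 p.2) :
    (A.tateGaloisRep ℓ h).toRepresentation = A.tateRep ℓ := rfl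

/-- The rational Tate module as a continuous Galois representation `GaloisRep K ℚ_[ℓ] (V_ℓ A)`,
given a proof `h` of joint continuity — supplied by `continuous_rationalTateRep A ℓ hℓ` (same
shape as G16 `WeierstrassCurve.rationalTateGaloisRep`). Serre–Tate 1968, §1. [cite: SerreTate1968, §1] -/
def _root_.Literature.AlgebraicGeometry.Motives.AbelianVariety.rationalTateGaloisRep
    (h : Continuous fun p : Field.absoluteGaloisGroup K × A.rationalTateModule ℓ ↦
      A.rationalTateRep ℓ p.1 p.2) :
    GaloisRepresentations.GaloisRep K ℚ_[ℓ] (A.rationalTateModule ℓ) :=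
  ⟨A.rationalTateRep ℓ, h⟩

variable {A ℓ} in
/-- The underlying representation of `rationalTateGaloisRep` is `rationalTateRep`. [folklore] -/
@[simp]
theorem _root_.Literature.AlgebraicGeometry.Motives.AbelianVariety.rationalTateGaloisRep_toRepresentation
    (h : Continuous fun p : Field.absoluteGaloisGroup K × A.rationalTateModule ℓ ↦
      A.rationalTateRep ℓ p.1 p.2) :
    (A.rationalTateGaloisRep ℓ h).toRepresentation = A.rationalTateRep ℓ := rfl

end AbelianVariety

end Literature.NumberTheory.DiophantineGeometry
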